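import Summits.BirchSwinnertonDyer.BirchSwinnertonDyer.Theorems.TwistFamilyManinDescentAssembly
import Summits.BirchSwinnertonDyer.BirchSwinnertonDyer.Theorems.TwistFamilyManinDescentTwistFamilyDescent
import Summits.BirchSwinnertonDyer.BirchSwinnertonDyer.Theorems.TwistFamilyManinDescentIsogenyTableFamiliesManinOne
import Summits.BirchSwinnertonDyer.BirchSwinnertonDyer.Theorems.TwistFamilyManinDescentIrreducibleAdditiveManinUnit
import Summits.BirchSwinnertonDyer.BirchSwinnertonDyer.Theses.ManinLocalTwoThree
import HarnessLib

/-!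
# Route `ManinLocalTwoThree`, residual crux C5 `ManinPrimeToAdditiveFiveLe` (stmt-BirchSwinnertonDyer-22969):
# **the two route copies of C5 are ONE proposition, and C5 follows from route `TwistFamilyManinDescent`'s THREE open nodes**

Lead seat bsd-line-ml23-c5-p1 (gen 6), orientation helper for the planners («book ONE decomposition of C5, not both»). The decl
`Theses.ManinLocalTwoThree.ManinPrimeToAdditiveFiveLe` (crux C5 of route `ManinLocalTwoThree`, line `upper_anchor`) and the decl
`Theses.TwistFamilyManinDescent.ManinPrimeToAdditiveFiveLe` (item X₅ of route `TwistFamilyManinDescent`, planner bsd-idea-3) have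
byte-identical bodies, so:

* `maninLocalTwoThree_maninPrimeToAdditiveFiveLe_iff_twistFamily` — `Iff.rfl`.
* `maninLocalTwoThree_maninPrimeToAdditiveFiveLe_of_twistFamilyLedger` — **C5 ⟸ `KatoIharaCremonaFacts` (stmt-25141, hypothesis bundle:
  F″ ∧ Ihara³ ∧ Cremona ≤ 5·10⁵) ∧ `LargePrimeReducibleJ` (stmt-25139) ∧ `EisensteinAdditiveManinResidual` (stmt-25138, SPLIT there into
  K15b 27071 / OrdinaryCorner 27552 / … by its glue)** — route `TwistFamilyManinDescent`'s CLOSED `Assembly` (stmt-25142,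
  `TwistFamilyManinDescent.assembly_proof`) with its three CLOSED inputs discharged by name (`twistFamilyDescent_proof` 25136,
  `isogenyTableFamiliesManinOne_proof` 25137, `irreducibleAdditiveManinUnit_proof` 25140).

Compare the line's own ledger of record (`…LedgerByNameOfKato.lean`, p631747): C5 ⟸ seven cite-only prints ∧ 27071 ∧ 27552 ∧
E-imc-5(5,7) ∧ E-imc-9(13). The two decompositions agree on 27071 / 27552 and differ in the treatment of the `p ≥ 11` reducible locus and of
the potentially supersingular orientation corner; this file lets a planner close C5 from EITHER book. HONEST STATUS: conditional-result
helper (`--supports … --as helper`); every named input is OPEN or cite-only; nothing here proves BSD, Manin's conjecture or C5.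

References: [Mazur1978] Thm. 1; [Kenku1982] Thm. 1; [Stevens1989] Lemmas (5.2), (5.4); [Kato2004Asterisque] Thm. 9.7;
[CesnaviciusNeururerSaha2023] Thm. 1.2; route TwistFamilyManinDescent (bsd-idea-3) items 25138–25142.
-/

set_option autoImplicit false
-- the Theorems namespace of this sub repeats the summit name by design (D-0017 nested layout)
set_option linter.dupNamespace false

noncomputable section

namespace Summit.BirchSwinnertonDyer.BirchSwinnertonDyer.Theorems

/-- **The two route copies of C5 are the same proposition** (identical bodies). [cite: EdixhovenManin1991, Thm. 3] -/
theorem maninLocalTwoThree_maninPrimeToAdditiveFiveLe_iff_twistFamily :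
    Summit.BirchSwinnertonDyer.BirchSwinnertonDyer.Theses.ManinLocalTwoThree.ManinPrimeToAdditiveFiveLe ↔
      Summit.BirchSwinnertonDyer.BirchSwinnertonDyer.Theses.TwistFamilyManinDescent.ManinPrimeToAdditiveFiveLe :=
  Iff.rfl

/-- **C5 (route `ManinLocalTwoThree`) ⟸ route `TwistFamilyManinDescent`'s three open nodes** — its closed `Assembly` (stmt-25142) with the
closed inputs `TwistFamilyDescent` (25136), `IsogenyTableFamiliesManinOne` (25137), `IrreducibleAdditiveManinUnit` (25140) discharged by
name. Conditional result (25141 is a cite-only bundle, 25139 and 25138 are open); closes nothing.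
[cite: Mazur1978, Thm. 1] [cite: Kenku1982, Thm. 1] [cite: Stevens1989, Lemmas (5.2), (5.4)] -/
theorem maninLocalTwoThree_maninPrimeToAdditiveFiveLe_of_twistFamilyLedger
    (hF : Summit.BirchSwinnertonDyer.BirchSwinnertonDyer.Theses.TwistFamilyManinDescent.KatoIharaCremonaFacts)
    (hL : Summit.BirchSwinnertonDyer.BirchSwinnertonDyer.Theses.TwistFamilyManinDescent.LargePrimeReducibleJ)
    (hR : Summit.BirchSwinnertonDyer.BirchSwinnertonDyer.Theses.TwistFamilyManinDescent.EisensteinAdditiveManinResidual) :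
    Summit.BirchSwinnertonDyer.BirchSwinnertonDyer.Theses.ManinLocalTwoThree.ManinPrimeToAdditiveFiveLe :=
  maninLocalTwoThree_maninPrimeToAdditiveFiveLe_iff_twistFamily.mpr
    (TwistFamilyManinDescent.assembly_proof hF TwistFamilyManinDescent.twistFamilyDescent_proof
      TwistFamilyManinDescent.isogenyTableFamiliesManinOne_proof hL
      TwistFamilyManinDescent.irreducibleAdditiveManinUnit_proof hR)

end Summit.BirchSwinnertonDyer.BirchSwinnertonDyer.Theorems

end
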